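import Summits.BirchSwinnertonDyer.Rank1Residual.X1.RankOneParitySqueezeLeaf
import Summits.BirchSwinnertonDyer.Rank1Residual.X1.ClassClosureN1
import Summits.BirchSwinnertonDyer.BirchSwinnertonDyer.Theorems.Rank1ResidualX1GoodEisenstein
import Summits.BirchSwinnertonDyer.BirchSwinnertonDyer.Theorems.SlopeDichotomyA2DegenerateLocusA2OrderParity
import HarnessLib

/-!
# The REGULATOR-FLOOR face of corner A2: `λ_an = 1` forces a pole `ord_p Reg_p + ord_p ∏c_ℓ ≤ μ_an − 1`
# of THE canonical `p`-adic regulator; hence memo T-λ3 «`λ_an ≥ 3` on A2» holds at every pair whose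
# regulator satisfies the Tamagawa floor `ord_p Reg_p + ord_p ∏c_ℓ ≥ 0`

Support file (prover seat `bsd-schneider-i1-c2`, gen 5, cell `bsd-schneider-ideate`; `--supports
stmt-BirchSwinnertonDyer-19086`, item `DegenerateLocusA2` of route `SlopeDichotomyA2`, rung I1-weaken =
README row C1 «certificate binder (Schneider)» on corner A2). THEOREMS ONLY; every open input enters BY
NAME (`hW16` Wuthrich 2014 Thm. 16, `hS` Perrin-Riou–Schneider at odd `p` = Balakrishnan–Müller–Stein
Thm. 1.7, `hmodP` modularity, `hGZK` Gross–Zagier–Kolyvagin) or as the cell's typed per-pair certificates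
(`AnalyticMuLE`, `AnalyticLambdaEq` of `X1/MuPart.lean`, `X1/ParitySqueeze.lean`). Nothing is booked.

WHY THIS FILE. The planner memo ROUTE-P3-v8-lambda-g10 (cell HOME, 2026-08-26) §1 states **T-λ3: every
A2 pair (`X1.TypeBRankOne`: good ordinary anomalous `p > 2`, `E[p]` reducible of Greenberg–Vatsal parity,
`ord_{s=1} L(E,s) = 1`) has `λ_an ≥ 3`**, by two cases: Case A (degenerate canonical height) is the
companion file `…DegenerateLocusA2OrderParity.lean` (gen 4, `three_le_lam_of_degenerate`, kernel-exact);
Case B (Schneider holds) reads the Perrin-Riou–Schneider leading term through one height lemma (H-int +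
E4 of the memo §1.3: `ord_p Reg_p + ord_p ∏c_ℓ ≥ 0` on the member with the unramified line — proved there
modulo two published height facts not yet typed: the Mazur–Tate isogeny adjunction and the `σ`-unit
statement). The memo's typed wish-list (§1.5) asks for (T1) = T-λ3 with the height lemma as hypothesis.
This file supplies (T1) in the kernel's currency — the exact analogue at `λ_an = 1` of x1b's exclusion
step inside `X1.RankOneParitySqueeze.mazurMainConjecture_of_analyticLambdaEq_three` — and its
HYPOTHESIS-FREE contrapositive:

* §1 (class-free: globally minimal `E`, odd good ordinary Eisenstein `p`, `r_an = 1`):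
  `padicRegulator_ne_zero_and_valuation_le_of_analyticLambdaEq_one` — `λ_an = 1 ∧ μ_an ≤ m ⇒ Reg_p ≠ 0`
  and `ord_p Reg_p + ord_p ∏c_ℓ + ord_p #Ш[p^∞] + 2·ord_p #Ẽ(𝔽_p) ≤ m + 1 + 2·ord_p #E(ℚ)_tors`.
* §2 (corner A2): `not_dvd_torsionOrder_of_typeBRankOne` (memo E1: type B has no rational `p`-torsion;
  x1a's `classX1_and_not_gvPar_of_dvd_torsionOrder` contrapositively), `p ∣ #Ẽ(𝔽_p)` (anomalous), whence
  `valuation_padicRegulator_add_le_of_typeBRankOne_of_analyticLambdaEq_one`: on A2, `λ_an = 1 ∧ μ_an ≤ m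
  ⇒ ord_p Reg_p + ord_p ∏c_ℓ + ord_p #Ш[p^∞] ≤ m − 1`; at `μ_an = 0` (Greenberg–Vatsal Thm. 1.3 in print;
  two-engine certificates on every census pair): `≤ −1` (`…_of_muZero_…`). So the unit-coefficient road
  P₁ could fire on A2 only at a pair whose canonical regulator has a POLE deeper than the Tamagawa product.
* §3 (T1 modulo T3-at-the-pair): `not_analyticLambdaEq_one_of_typeBRankOne_of_regTamFloor` — on A2,
  `μ_an = 0` and the floor `Reg_p ≠ 0 → 0 ≤ ord_p Reg_p + ord_p ∏c_ℓ` (memo Lemma E4's conclusion AT THE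
  PAIR; data 2 797/2 797 census pairs, HOME kit/A2-LAMBDA-CENSUS) exclude `λ_an = 1`; with λ-parity
  (`RankOne.Leaf.odd_of_analyticLambdaEq`, PROVED) a certified `λ_an` is `≥ 3`
  (`three_le_of_analyticLambdaEq_of_typeBRankOne_of_regTamFloor`); the floor binder is idle on the
  DEGENERATE locus (`not_analyticLambdaEq_one_of_degenerate`, gen 4's theorem), and item 19086 restricted
  to `{λ_an = 1}` is vacuous (`degenerateLocusA2_on_lamOne`).

Relation to item 19086 (frontier ledger; verdict DECIDED-REDUCED of g2/g3 unchanged): the degenerate locus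
`{Reg_p = 0} ⊂ A2` and the stratum `{λ_an = 1}` are DISJOINT (gen 4), and `{λ_an = 1} ∩ A2` itself is
confined to `{ord_p Reg_p + ord_p ∏c_ℓ ≤ −1}` (this file) — empty by H-int + E4, empty on the census.
No λ/μ-type census can detect or exclude a degenerate pair; only non-vanishing certificates (per pair)
or the K5 / Schneider inputs (per class) bear on 19086. What this is NOT: not T-λ3 unconditionally (the
height floor is a per-pair hypothesis here; its class-wide proof is the memo's H-int + E4, whose two
height facts are a Literature typing task); not a statement about `#Ш`; no booking changes.

References: [BalakrishnanMullerStein2015] Thm. 1.7; [Schneider1985] Thm. 2′; [PerrinRiou1987] §1.4;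
[Wuthrich2014] Thm. 16; [GreenbergVatsal2000] Thm. (1.3), (1)–(2); [GreenbergLNM1716] §4 p. 110, §5
p. 183; [MazurTate1983Biext] §3.3 (the value subgroup: source of the floor); [HatleyKunduRay2021TAMS]
Cor. 3.12 / Thm. 3.13 (truncated Euler characteristic `R_p/p^r` off anomalous primes); cell memo
ROUTE-P3-v8-lambda-g10 §1 (T1)–(T3).
-/

set_option autoImplicit false

noncomputable section

open scoped Classical MatrixGroups ModularForm

open PowerSeries CongruenceSubgroup WeierstrassCurve Literature.NumberTheory.EllipticCurves
  Literature.NumberTheory.EllipticCurves.ModularForms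
  Literature.NumberTheory.EllipticCurves.Rank1Residual
  Summit.BirchSwinnertonDyer.Rank1Residual
  Summit.BirchSwinnertonDyer.BirchSwinnertonDyer.Theorems.Rank1ResidualX1Defs
  Summit.BirchSwinnertonDyer.Rank1Residual.X1.MuLambda
  Summit.BirchSwinnertonDyer.Rank1Residual.X1.MuPart
  Summit.BirchSwinnertonDyer.Rank1Residual.X1.ParitySqueeze
  Summit.BirchSwinnertonDyer.Rank1Residual.X1.RankOneParitySqueeze
  Summit.BirchSwinnertonDyer.BirchSwinnertonDyer.Theses
  Summit.BirchSwinnertonDyer.BirchSwinnertonDyer.Theorems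

-- `Summit.BirchSwinnertonDyer.BirchSwinnertonDyer.…`: the summit and its single sub-problem share a name (D-0017 layout).
set_option linter.dupNamespace false

namespace Summit.BirchSwinnertonDyer.BirchSwinnertonDyer.Theorems.DegenerateLocusA2RegulatorFloor

/-! ## §1. Class-free: `λ_an = 1` pins THE canonical regulator (non-zero, with an explicit valuation ceiling) -/

section ClassFree

variable {W : WeierstrassCurve ℚ} [W.IsElliptic] [W.IsGloballyMinimal] {p : ℕ} [Fact p.Prime]

/-- **`λ_an = 1` forces a non-zero canonical regulator with a valuation CEILING.** Let `W/ℚ` be globally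
minimal elliptic, `p ≠ 2` good ordinary with `E[p]` reducible and `ord_{s=1} L(E,s) = 1`; granted the
PUBLISHED named facts Wuthrich 2014 Thm. 16 (`hW16`), Perrin-Riou–Schneider at odd `p` (`hS`, all three
clauses) and Gross–Zagier–Kolyvagin (`hGZK`), and the per-pair certificates `μ_an ≤ m` (`hμan`) and
`λ_an = 1` (`hlam1`) for the newform `f` at level `N_E` with `ϖ·Ω_E = Ω⁺_f` (`hf`, `hϖ`): for every
CANONICAL height datum `Dh`, `Reg_p(Dh) ≠ 0` and
`ord_p Reg_p + ord_p ∏c_ℓ + ord_p #Ш[p^∞] + 2·ord_p #Ẽ(𝔽_p) ≤ m + 1 + 2·ord_p #E(ℚ)_tors`.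
Mechanism: `ϖ·L_p = ι(f_E·h)` with `char X = (f_E)`; `λ(f_E·h) = 1` and `1 = rank ≤ ord_T f_E ≤ λ(f_E)`
give `ord_T f_E = rank = 1`, so (BMS Thm. 1.7 (2)) Schneider holds and `Ш[p^∞]` is finite, and (3) the
leading term `[T¹]f_E · log_p(γ) · #tors² = u · (1−α⁻¹)² · #Ш[p^∞] · Reg_p · ∏c_ℓ`, where
`ord_p [T¹]f_E = μ(f_E) ≤ μ(f_E·h) ≤ m`, `ord_p log_p(γ) = 1`, `ord_p (1−α⁻¹) = ord_p #Ẽ(𝔽_p)`.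
[cite: BalakrishnanMullerStein2015, Thm. 1.7] [cite: Wuthrich2014, Thm. 16 (p. 393)]
[cite: GreenbergVatsal2000, p. 2–3, (1)–(2)] [cite: Iwasawa1972PadicL, §4.4] -/
theorem padicRegulator_ne_zero_and_valuation_le_of_analyticLambdaEq_one_at
    (hW16 : Wuthrich2014.charIdeal_dvd_padicLFunction) (hS : Schneider1985_order_charGenerator_odd)
    (hGZK : rank_eq_analyticRank_of_analyticRank_le_one)
    (hp : p ≠ 2) (hgood : W.HasGoodReductionAtPrime p) (hord : ¬ (p : ℤ) ∣ W.frobeniusTrace p)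
    (hred : ¬ W.HasIrreducibleModPGaloisRep p) (han : W.analyticRank = 1)
    [NeZero (W.conductorNorm ℤ)] {f : CuspForm (Gamma0 (W.conductorNorm ℤ)) 2} (hf : IsNewformOf W f)
    {ϖ : ℚ} (hϖ : (ϖ : ℝ) * W.realPeriodRat = plusPeriod f)
    {m : ℕ} (hμan : AnalyticMuLE W p m) (hlam1 : AnalyticLambdaEq W p 1)
    {Dh : PAdicHeightData W p} (hDh : Dh.IsCanonical) :
    padicRegulator Dh ≠ 0 ∧
      (padicRegulator Dh).valuation + (padicValNat p W.tamagawaProduct : ℤ) +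
          (padicValNat p (Nat.card (AddCommGroup.primaryComponent W.sha p)) : ℤ) +
          2 * (padicValNat p (W.reductionPointCount p) : ℤ) ≤
        (m : ℤ) + 1 + 2 * (padicValNat p W.torsionOrder : ℤ) := by
  have hpP : p.Prime := Fact.out
  have hordp : IsOrdinaryAt W p := ⟨hgood, hord⟩
  obtain ⟨κ, hκ, γ, hγ, hγ'⟩ := exists_isCyclotomic_isTopGenerator_isCyclotomicVariable_holds p
  obtain ⟨D⟩ := W.nonempty_selmerDualData_holds κ γ hγ
  haveI : Module.Finite (IwasawaAlgebra p) D.X := D.module_finite_holds hγ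
  -- Wuthrich Thm. 16: `X` torsion, `ι g = ϖ · L_p(f, α)` with `g ∈ char X = (fE)`, `g = fE · h`
  obtain ⟨hX, g, hgmem, hιg⟩ := hW16 W p hp hordp hred hκ hγ hγ' hf D ϖ hϖ
  haveI : (Literature.NumberTheory.EllipticCurves.Module.charIdeal (IwasawaAlgebra p) D.X).IsPrincipal :=
    charIdeal_isPrincipal_holds p D.X
  obtain ⟨fE, hchar⟩ := Submodule.IsPrincipal.principal
    (Literature.NumberTheory.EllipticCurves.Module.charIdeal (IwasawaAlgebra p) D.X)
  have hchar' : D.charIdeal = Ideal.span {fE} := hchar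
  have hgmem' : g ∈ Ideal.span {fE} := by rw [← hchar']; exact hgmem
  obtain ⟨h, hgh⟩ := Ideal.mem_span_singleton'.mp hgmem'
  have hfac : fE * h = g := by rw [mul_comm]; exact hgh
  have hιg' : iwasawaToPowerSeries p (fE * h) =
      C (ϖ : ℚ_[p]) * padicLFunction f (unitRoot W p : ℚ_[p]) := by rw [hfac, hιg]
  have hg0 : fE * h ≠ 0 := mul_ne_zero_of_iota_eq hgood hord hf hϖ D hιg'
  have hfE0 : fE ≠ 0 := fun h0 ↦ hg0 (by rw [h0, zero_mul])
  have hh0 : h ≠ 0 := fun h0 ↦ hg0 (by rw [h0, mul_zero])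
  have hμm : mu (fE * h) ≤ m := by
    obtain ⟨n, hn⟩ := hμan f hf ϖ hϖ
    rw [← hιg'] at hn
    exact mu_le_of_lt_norm_coeff hn
  have hμfE : mu fE ≤ m := (mu_le_mu_mul hfE0 hh0).trans hμm
  have hlam' : lam (fE * h) = 1 := hlam1 f hf ϖ hϖ (fE * h) hιg'
  have hle1 : lam fE ≤ 1 := by rw [← hlam']; exact lam_le_lam_mul hfE0 hh0
  -- GZK: rank one; Perrin-Riou–Schneider (1): `rank ≤ ord_T fE ≤ λ(fE) ≤ 1`, so `ord_T fE = rank`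
  obtain ⟨hrk, -⟩ := hGZK W han.le
  have hr1 : W.mordellWeilRank = 1 := hrk.trans han
  obtain ⟨hS1, hS2, hS3⟩ := hS W p hp hgood hord κ γ hκ hγ hγ' D hX fE hchar' Dh hDh
  have h1 : lam fE = 1 := by
    refine le_antisymm hle1 ?_
    have e : ((W.mordellWeilRank : ℕ) : ℕ∞) ≤ (lam fE : ℕ∞) := hS1.trans (order_le_lam hfE0)
    rw [hr1] at e
    exact_mod_cast e
  have hordfE : fE.order = W.mordellWeilRank := by
    refine le_antisymm ?_ hS1
    have e := order_le_lam hfE0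
    rw [h1] at e
    rw [hr1]
    exact_mod_cast e
  obtain ⟨hSch, hfin⟩ := hS2.mp hordfE
  refine ⟨hSch, ?_⟩
  obtain ⟨u, hu⟩ := hS3 hSch hfin
  rw [hr1, pow_one] at hu
  obtain ⟨hc0, hcval⟩ := valuation_coeff_lam hfE0
  rw [h1] at hc0 hcval
  set c1 : ℚ_[p] := ((coeff 1 fE : ℤ_[p]) : ℚ_[p]) with hc1
  set lg : ℚ_[p] := padicLog p (cyclotomicGenerator p) with hlg
  set Tt : ℚ_[p] := (W.torsionOrder : ℚ_[p]) with hTt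
  set ε : ℚ_[p] := (1 - (unitRoot W p : ℚ_[p])⁻¹) with hε
  set Shp : ℚ_[p] := (Nat.card (AddCommGroup.primaryComponent W.sha p) : ℚ_[p]) with hShp
  set Rg : ℚ_[p] := padicRegulator Dh with hRg
  set Cc : ℚ_[p] := (W.tamagawaProduct : ℚ_[p]) with hCc
  obtain ⟨u₃, hu₃⟩ := exists_unit_padicLog_cyclotomicGenerator p hp
  have hp0 : (p : ℚ_[p]) ≠ 0 := Nat.cast_ne_zero.mpr hpP.ne_zero
  have hlg' : lg = (p : ℚ_[p]) * ((u₃ : ℤ_[p]) : ℚ_[p]) := by rw [hlg]; exact hu₃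
  have hlg0 : lg ≠ 0 := by rw [hlg']; exact mul_ne_zero hp0 (coe_units_ne_zero p u₃)
  have hTt0 : Tt ≠ 0 := by rw [hTt]; exact_mod_cast (W.torsionOrder_pos_holds).ne'
  obtain ⟨u₂, hu₂⟩ := exists_unit_one_sub_unitRoot_inv p W hordp
  have hε' : ε = ((u₂ : ℤ_[p]) : ℚ_[p]) * (W.reductionPointCount p : ℚ_[p]) := by rw [hε]; exact hu₂
  have hN0 : (W.reductionPointCount p : ℚ_[p]) ≠ 0 := by
    exact_mod_cast (W.reductionPointCount_pos p).ne'
  have hε0 : ε ≠ 0 := by rw [hε']; exact mul_ne_zero (coe_units_ne_zero p u₂) hN0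
  haveI : Finite (AddCommGroup.primaryComponent W.sha p) := hfin
  have hShp0 : Shp ≠ 0 := by rw [hShp]; exact_mod_cast Nat.card_pos.ne'
  have hRg0 : Rg ≠ 0 := hSch
  have hCc0 : Cc ≠ 0 := by
    rw [hCc]; exact_mod_cast (W.tamagawaProduct_pos_holds : 0 < W.tamagawaProduct).ne'
  have hvlg : lg.valuation = 1 := by
    rw [hlg', Padic.valuation_mul hp0 (coe_units_ne_zero p u₃), Padic.valuation_p,
      valuation_coe_units_eq_zero, add_zero]
  have hvT : Tt.valuation = (padicValNat p W.torsionOrder : ℤ) := by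
    rw [hTt, Padic.valuation_natCast]
  have hvε : ε.valuation = (padicValNat p (W.reductionPointCount p) : ℤ) := by
    rw [hε', Padic.valuation_mul (coe_units_ne_zero p u₂) hN0, valuation_coe_units_eq_zero, zero_add,
      Padic.valuation_natCast]
  have hvS : Shp.valuation =
      (padicValNat p (Nat.card (AddCommGroup.primaryComponent W.sha p)) : ℤ) := by
    rw [hShp, Padic.valuation_natCast]
  have hvC : Cc.valuation = (padicValNat p W.tamagawaProduct : ℤ) := by
    rw [hCc, Padic.valuation_natCast]
  -- valuations in the leading-term identity `c1 · lg · Tt² = u · (ε² · (Shp · (Rg · Cc)))`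
  have hval := congrArg Padic.valuation hu
  rw [Padic.valuation_mul (mul_ne_zero hc0 hlg0) (pow_ne_zero 2 hTt0), Padic.valuation_mul hc0 hlg0,
    Padic.valuation_pow,
    Padic.valuation_mul (coe_units_ne_zero p u) (mul_ne_zero (pow_ne_zero 2 hε0)
      (mul_ne_zero (mul_ne_zero hShp0 hRg0) hCc0)),
    valuation_coe_units_eq_zero, zero_add,
    Padic.valuation_mul (pow_ne_zero 2 hε0) (mul_ne_zero (mul_ne_zero hShp0 hRg0) hCc0),
    Padic.valuation_pow, Padic.valuation_mul (mul_ne_zero hShp0 hRg0) hCc0,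
    Padic.valuation_mul hShp0 hRg0, hcval, hvlg, hvT, hvε, hvS, hvC] at hval
  have hμfE' : (mu fE : ℤ) ≤ m := by exact_mod_cast hμfE
  push_cast at hval ⊢
  linarith

/-- **Class-free packaged form** (the newform and `ϖ` supplied by modularity `hmodP`): at a globally
minimal `E`, `p ≠ 2` good ordinary Eisenstein, `ord_{s=1} L(E,s) = 1`, with `μ_an ≤ m` and `λ_an = 1`:
for every canonical `Dh`, `Reg_p(Dh) ≠ 0` and
`ord_p Reg_p + ord_p ∏c_ℓ + ord_p #Ш[p^∞] + 2·ord_p #Ẽ(𝔽_p) ≤ m + 1 + 2·ord_p #E(ℚ)_tors`.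
[cite: BalakrishnanMullerStein2015, Thm. 1.7] [cite: Wuthrich2014, Thm. 16 (p. 393)] -/
theorem padicRegulator_ne_zero_and_valuation_le_of_analyticLambdaEq_one
    (hW16 : Wuthrich2014.charIdeal_dvd_padicLFunction) (hS : Schneider1985_order_charGenerator_odd)
    (hmodP : nonempty_modularParametrizationData) (hGZK : rank_eq_analyticRank_of_analyticRank_le_one)
    (hp : p ≠ 2) (hgood : W.HasGoodReductionAtPrime p) (hord : ¬ (p : ℤ) ∣ W.frobeniusTrace p)
    (hred : ¬ W.HasIrreducibleModPGaloisRep p) (han : W.analyticRank = 1)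
    {m : ℕ} (hμan : AnalyticMuLE W p m) (hlam1 : AnalyticLambdaEq W p 1)
    {Dh : PAdicHeightData W p} (hDh : Dh.IsCanonical) :
    padicRegulator Dh ≠ 0 ∧
      (padicRegulator Dh).valuation + (padicValNat p W.tamagawaProduct : ℤ) +
          (padicValNat p (Nat.card (AddCommGroup.primaryComponent W.sha p)) : ℤ) +
          2 * (padicValNat p (W.reductionPointCount p) : ℤ) ≤
        (m : ℤ) + 1 + 2 * (padicValNat p W.torsionOrder : ℤ) := by
  haveI : NeZero (W.conductorNorm ℤ) := ⟨(W.conductorNorm_pos_holds).ne'⟩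
  obtain ⟨Dm⟩ := hmodP W
  have hf : IsNewformOf W Dm.f := Dm.isNewformOf
  obtain ⟨ϖ, -, hϖeq, -⟩ := Dm.exists_rat_mul_realPeriodRat_eq_plusPeriod
  exact padicRegulator_ne_zero_and_valuation_le_of_analyticLambdaEq_one_at hW16 hS hGZK hp hgood hord
    hred han hf hϖeq hμan hlam1 hDh

end ClassFree

/-! ## §2. Corner A2: no rational `p`-torsion, `p ∣ #Ẽ(𝔽_p)`, and the regulator POLE forced by `λ_an = 1` -/

section CornerA2

variable (W : WeierstrassCurve ℚ) [W.IsElliptic] [W.IsGloballyMinimal] (p : ℕ) [Fact p.Prime]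

/-- **(E1) Type B has no rational `p`-torsion**: on corner A2, `p ∤ #E(ℚ)_tors` — a rational point of
order `p` at a good `p > 2` spans an unramified EVEN rational line and forces type A
(x1a `classX1_and_not_gvPar_of_dvd_torsionOrder`), contradicting `GVPar`. The hypothesis `htors` of
x1b's `RankOne.Leaf.mazurMainConjecture_and_bsdp_of_muZero_lamThree_of_not_dvd_torsionOrder` is thus
automatic on A2. [cite: GreenbergVatsal2000, Thm. (1.3)] [cite: SilvermanAEC2009, VII.3.4] -/
theorem not_dvd_torsionOrder_of_typeBRankOne (hB : X1.TypeBRankOne W p) : ¬ p ∣ W.torsionOrder := by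
  intro htor
  obtain ⟨hX1, -, hGV⟩ := hB
  exact (Rank1ResidualX1GoodEisenstein.classX1_and_not_gvPar_of_dvd_torsionOrder W p hX1.1 hX1.2.2.1
    htor).2 hGV

omit [W.IsElliptic] in
/-- **(E2, lower half) `p ∣ #Ẽ(𝔽_p)` on corner A2** (anomalous: `a_p ≡ 1 (mod p)`), i.e.
`1 ≤ ord_p #Ẽ(𝔽_p)` — the rank-one leaf lemma of x1b restated for `X1.TypeBRankOne`. [folklore] -/
theorem one_le_padicValNat_reductionPointCount_of_typeBRankOne (hB : X1.TypeBRankOne W p) :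
    1 ≤ padicValNat p (W.reductionPointCount p) :=
  (X1.RankOne.leaf_of_classX1 hB.1 hB.2.1).one_le_padicValNat_reductionPointCount

variable {W p}

/-- **On corner A2, `λ_an = 1 ∧ μ_an ≤ m` forces `Reg_p ≠ 0` and the POLE
`ord_p Reg_p + ord_p ∏c_ℓ + ord_p #Ш[p^∞] ≤ m − 1`** for THE canonical regulator — §1 with
`ord_p #E(ℚ)_tors = 0` (E1) and `ord_p #Ẽ(𝔽_p) ≥ 1` (anomalous). Granted W16, Perrin-Riou–Schneider,
modularity, GZK by name. [cite: BalakrishnanMullerStein2015, Thm. 1.7] [cite: Wuthrich2014, Thm. 16 (p. 393)]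
[cite: GreenbergVatsal2000, Thm. (1.3) and (1)–(2)] -/
theorem valuation_padicRegulator_add_le_of_typeBRankOne_of_analyticLambdaEq_one
    (hW16 : Wuthrich2014.charIdeal_dvd_padicLFunction) (hS : Schneider1985_order_charGenerator_odd)
    (hmodP : nonempty_modularParametrizationData) (hGZK : rank_eq_analyticRank_of_analyticRank_le_one)
    (hB : X1.TypeBRankOne W p) {m : ℕ} (hμan : AnalyticMuLE W p m) (hlam1 : AnalyticLambdaEq W p 1)
    {Dh : PAdicHeightData W p} (hDh : Dh.IsCanonical) :
    padicRegulator Dh ≠ 0 ∧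
      (padicRegulator Dh).valuation + (padicValNat p W.tamagawaProduct : ℤ) +
          (padicValNat p (Nat.card (AddCommGroup.primaryComponent W.sha p)) : ℤ) ≤ (m : ℤ) - 1 := by
  have hX := isClassX1_of_classX1 hB.1
  obtain ⟨hR, hle⟩ := padicRegulator_ne_zero_and_valuation_le_of_analyticLambdaEq_one hW16 hS hmodP
    hGZK hX.two_ne hX.hasGoodReductionAtPrime hX.not_dvd_frobeniusTrace hX.not_hasIrreducibleModPGaloisRep
    hB.2.1 hμan hlam1 hDh
  refine ⟨hR, ?_⟩
  have ht : (padicValNat p W.torsionOrder : ℤ) = 0 := by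
    exact_mod_cast padicValNat.eq_zero_of_not_dvd (not_dvd_torsionOrder_of_typeBRankOne W p hB)
  have hN : (1 : ℤ) ≤ padicValNat p (W.reductionPointCount p) := by
    exact_mod_cast one_le_padicValNat_reductionPointCount_of_typeBRankOne W p hB
  rw [ht] at hle
  linarith

/-- **On corner A2 at `μ_an = 0`: `λ_an = 1` forces `ord_p Reg_p + ord_p ∏c_ℓ + ord_p #Ш[p^∞] ≤ −1`**, in
particular `ord_p Reg_p + ord_p ∏c_ℓ ≤ −1` — a pole of THE canonical regulator deeper than the Tamagawa
product. (`μ_an = 0` on type B is Greenberg–Vatsal's Thm. (1.3) in print; in the kernel it is the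
per-pair certificate `AnalyticMuLE W p 0`, on file for every census pair.)
[cite: GreenbergVatsal2000, Thm. (1.3)] [cite: BalakrishnanMullerStein2015, Thm. 1.7] -/
theorem valuation_padicRegulator_add_le_of_typeBRankOne_of_muZero_of_analyticLambdaEq_one
    (hW16 : Wuthrich2014.charIdeal_dvd_padicLFunction) (hS : Schneider1985_order_charGenerator_odd)
    (hmodP : nonempty_modularParametrizationData) (hGZK : rank_eq_analyticRank_of_analyticRank_le_one)
    (hB : X1.TypeBRankOne W p) (hμ0 : AnalyticMuLE W p 0) (hlam1 : AnalyticLambdaEq W p 1)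
    {Dh : PAdicHeightData W p} (hDh : Dh.IsCanonical) :
    padicRegulator Dh ≠ 0 ∧
      (padicRegulator Dh).valuation + (padicValNat p W.tamagawaProduct : ℤ) ≤ -1 := by
  obtain ⟨hR, hle⟩ := valuation_padicRegulator_add_le_of_typeBRankOne_of_analyticLambdaEq_one hW16 hS
    hmodP hGZK hB hμ0 hlam1 hDh
  refine ⟨hR, ?_⟩
  have hS0 : (0 : ℤ) ≤ padicValNat p (Nat.card (AddCommGroup.primaryComponent W.sha p)) := by
    exact_mod_cast Nat.zero_le _
  simp only [Nat.cast_zero, zero_sub] at hle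
  linarith

end CornerA2

/-! ## §3. T-λ3 modulo the regulator floor AT THE PAIR (memo ROUTE-P3 v8 (T1) with (T3) as the binder) -/

section RegTamFloor

variable {W : WeierstrassCurve ℚ} [W.IsElliptic] [W.IsGloballyMinimal] {p : ℕ} [Fact p.Prime]

/-- **The unit-coefficient road P₁ is VOID on corner A2 under the regulator–Tamagawa floor** (memo
ROUTE-P3 v8 (T1), kernel form): at an A2 pair with `μ_an = 0`, if THE canonical regulator satisfies
`Reg_p ≠ 0 → 0 ≤ ord_p Reg_p + ord_p ∏c_ℓ` (the conclusion of the memo's Lemma H-int + E4 at this pair;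
data 2 797/2 797 census pairs), then `λ_an ≠ 1`. Both cases of the memo at once: on the degenerate locus
`λ_an = 1` would force `Reg_p ≠ 0` (§1), and off it the floor contradicts the pole `≤ −1` (§2).
[cite: GreenbergVatsal2000, Thm. (1.3)] [cite: BalakrishnanMullerStein2015, Thm. 1.7]
[cite: Wuthrich2014, Thm. 16 (p. 393)] [cite: MazurTate1983Biext, §3.3] -/
theorem not_analyticLambdaEq_one_of_typeBRankOne_of_regTamFloor
    (hW16 : Wuthrich2014.charIdeal_dvd_padicLFunction) (hS : Schneider1985_order_charGenerator_odd)
    (hMT : mazur_tate_sigma_exists_odd) (hmodP : nonempty_modularParametrizationData)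
    (hGZK : rank_eq_analyticRank_of_analyticRank_le_one)
    (hB : X1.TypeBRankOne W p) (hμ0 : AnalyticMuLE W p 0)
    (hRT : ∀ Dh : PAdicHeightData W p, Dh.IsCanonical → padicRegulator Dh ≠ 0 →
      0 ≤ (padicRegulator Dh).valuation + (padicValNat p W.tamagawaProduct : ℤ)) :
    ¬ AnalyticLambdaEq W p 1 := by
  intro hlam1
  have hX := isClassX1_of_classX1 hB.1
  obtain ⟨Dh, hDh, -⟩ := existsUnique_isCanonical_of_odd hMT W p hX.two_ne hX.hasGoodReductionAtPrime
    hX.not_dvd_frobeniusTrace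
  obtain ⟨hR, hle⟩ :=
    valuation_padicRegulator_add_le_of_typeBRankOne_of_muZero_of_analyticLambdaEq_one hW16 hS hmodP
      hGZK hB hμ0 hlam1 hDh
  have h0 := hRT Dh hDh hR
  linarith

/-- **T-λ3 modulo the floor: a certified `λ_an` on corner A2 is at least `3`.** Under the hypotheses of
`not_analyticLambdaEq_one_of_typeBRankOne_of_regTamFloor`, any certified value `λ_an = n` has `n ≥ 3`:
`n` is ODD on the rank-one leaf (`RankOne.Leaf.odd_of_analyticLambdaEq`, PROVED from the Mazur–Tate–
Teitelbaum functional equation) and `n ≠ 1`. [cite: MazurTateTeitelbaum1986Invent, §I.17–I.18]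
[cite: GreenbergVatsal2000, Thm. (1.3)] [cite: BalakrishnanMullerStein2015, Thm. 1.7] -/
theorem three_le_of_analyticLambdaEq_of_typeBRankOne_of_regTamFloor
    (hW16 : Wuthrich2014.charIdeal_dvd_padicLFunction) (hS : Schneider1985_order_charGenerator_odd)
    (hMT : mazur_tate_sigma_exists_odd) (hmodP : nonempty_modularParametrizationData)
    (hGZK : rank_eq_analyticRank_of_analyticRank_le_one)
    (hB : X1.TypeBRankOne W p) (hμ0 : AnalyticMuLE W p 0)
    (hRT : ∀ Dh : PAdicHeightData W p, Dh.IsCanonical → padicRegulator Dh ≠ 0 →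
      0 ≤ (padicRegulator Dh).valuation + (padicValNat p W.tamagawaProduct : ℤ))
    {n : ℕ} (hn : AnalyticLambdaEq W p n) : 3 ≤ n := by
  have hodd : Odd n := (X1.RankOne.leaf_of_classX1 hB.1 hB.2.1).odd_of_analyticLambdaEq hW16 hmodP hn
  have hne1 : n ≠ 1 := by
    rintro rfl
    exact not_analyticLambdaEq_one_of_typeBRankOne_of_regTamFloor hW16 hS hMT hmodP hGZK hB hμ0 hRT hn
  obtain ⟨k, rfl⟩ := hodd
  omega

/-- **Idle-binder check: with a degenerate canonical datum the floor is not needed at all** (gen 4's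
`three_le_of_analyticLambdaEq_of_degenerate` — recorded here next to the floor form so that the two cases
of memo T-λ3 sit side by side): on the degenerate locus of A2, `λ_an ≠ 1` outright.
[cite: PerrinRiou1987, §1.4 Cor. 1.8] [cite: Wuthrich2014, Thm. 16 (p. 393)] -/
theorem not_analyticLambdaEq_one_of_degenerate
    (hW16 : Wuthrich2014.charIdeal_dvd_padicLFunction) (hmodP : nonempty_modularParametrizationData)
    (hPR : perrinRiou_rankOne_leadingTerms_odd) (hGZK : rank_eq_analyticRank_of_analyticRank_le_one)
    (hB : X1.TypeBRankOne W p)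
    (hdeg : ∃ Dh : PAdicHeightData W p, Dh.IsCanonical ∧ ¬ SchneiderConjecture Dh) :
    ¬ AnalyticLambdaEq W p 1 := fun h1 ↦ by
  have h3 := DegenerateLocusA2OrderParity.three_le_of_analyticLambdaEq_of_degenerate hW16 hmodP hPR hGZK
    hB hdeg h1
  omega

/-- **Item 19086 on the stratum `{λ_an = 1}` is vacuous** (granted W16, Perrin-Riou–Schneider, modularity,
GZK and the certificate `μ_an = 0`): an A2 pair with `λ_an = 1` carries NO degenerate canonical datum
(§2: every canonical `Reg_p ≠ 0`), so `BSDp` follows from `False` there; the degenerate locus and the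
stratum `{λ_an = 1}` are disjoint (content of 19086 lives on `{λ_an ≥ 3}`, gen 4).
[cite: BalakrishnanMullerStein2015, Thm. 1.7] [cite: GreenbergVatsal2000, Thm. (1.3)] -/
theorem degenerateLocusA2_on_lamOne
    (hW16 : Wuthrich2014.charIdeal_dvd_padicLFunction) (hS : Schneider1985_order_charGenerator_odd)
    (hmodP : nonempty_modularParametrizationData) (hGZK : rank_eq_analyticRank_of_analyticRank_le_one)
    (W : WeierstrassCurve ℚ) [W.IsElliptic] [W.IsGloballyMinimal] (p : ℕ) [Fact p.Prime]
    (hB : X1.TypeBRankOne W p) (hμ0 : AnalyticMuLE W p 0) (hlam1 : AnalyticLambdaEq W p 1)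
    (hdeg : ∃ Dh : PAdicHeightData W p, Dh.IsCanonical ∧ ¬ SchneiderConjecture Dh) : BSDp W p := by
  obtain ⟨Dh, hDh, hnot⟩ := hdeg
  exact (hnot (valuation_padicRegulator_add_le_of_typeBRankOne_of_muZero_of_analyticLambdaEq_one hW16 hS
    hmodP hGZK hB hμ0 hlam1 hDh).1).elim

end RegTamFloor

end Summit.BirchSwinnertonDyer.BirchSwinnertonDyer.Theorems.DegenerateLocusA2RegulatorFloor

end
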